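import Summits.PneNP.PneNP.Theorems.BavardGapOrbitCount
import Literature.Computability.Complexity.BoolEncodings

/-!
# Route BavardGap — from the verifier's specification to pairings (helper for `PgDecisionInNP`, stmt-PneNP-2498)

List-level facts linking the typed verifier's specification (`BavardGapPgProgram`) to the language of the route:
the two bits of a letter inside `l.flatMap (fun a => [[a.1 = 1], a.2])`; permutations of `Fin m` as lists of images;
the iterates of `σ = (finRotate m).trans π` read off the list; and the count of orbit minima over `[0, m)` versus the cycle
count `card (cycleType σ) + #fixed points` (`BavardGapOrbitCount`).
-/

set_option linter.dupNamespace false -- `Summit.PneNP.PneNP.…`: summit = sub-problem name (D-0017 single-conjunct layout)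

namespace Summit.PneNP.PneNP.Theorems

open Finset

/-- The two bits of letter `i` in the letter code. [folklore] -/
theorem bavardGap_getD_flatMap : ∀ (l : List (Fin 2 × Bool)) (i : ℕ) (hi : i < l.length),
    (l.flatMap fun a => [decide (a.1 = 1), a.2]).getD (2 * i) false = decide ((l[i]).1 = 1) ∧
      (l.flatMap fun a => [decide (a.1 = 1), a.2]).getD (2 * i + 1) false = (l[i]).2
  | [], i, hi => absurd hi (by simp)
  | a :: l, 0, _ => by simp
  | a :: l, i + 1, hi => by
    have h := bavardGap_getD_flatMap l i (by simpa using hi)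
    rw [List.flatMap_cons, show 2 * (i + 1) = 2 * i + 1 + 1 by ring]
    simp only [List.cons_append, List.nil_append, List.getD_cons_succ, List.getElem_cons_succ]
    exact h

/-- The letter code has two bits per letter. [folklore] -/
theorem bavardGap_length_flatMap (l : List (Fin 2 × Bool)) : (l.flatMap fun a => [decide (a.1 = 1), a.2]).length = 2 * l.length := by
  induction l with
  | nil => rfl
  | cons a l ih => rw [List.flatMap_cons, List.length_append, ih, List.length_cons]; simp; ring

/-- Rotation by one, on values. [folklore] -/
theorem bavardGap_val_finRotate : ∀ {m : ℕ} (y : Fin m), ((finRotate m y : Fin m) : ℕ) = ((y : ℕ) + 1) % m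
  | 0, y => y.elim0
  | m + 1, y => by
    rw [finRotate_apply, Fin.val_add, Fin.val_one', Nat.add_mod_mod]

/-- **Iterates of `σ = (finRotate m).trans π` read off the list of images of `π`.** [folklore] -/
theorem bavardGap_val_pow_apply {m : ℕ} (π : Equiv.Perm (Fin m)) (p : List ℕ) (hp : ∀ j : Fin m, p.getD j 0 = π j) (i : Fin m) :
    ∀ k : ℕ, ((((finRotate m).trans π) ^ k) i : ℕ) = (fun c => p.getD ((c + 1) % m) 0)^[k] i
  | 0 => rfl
  | k + 1 => by
    rw [Function.iterate_succ_apply', ← bavardGap_val_pow_apply π p hp i k, pow_succ', Equiv.Perm.mul_apply, Equiv.trans_apply,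
      ← hp, bavardGap_val_finRotate]

/-- **A permutation from its list of images.** [folklore] -/
theorem bavardGap_exists_perm_of_list {m : ℕ} (p : List ℕ) (hlen : p.length = m) (hlt : ∀ a ∈ p, a < m) (hnd : p.Nodup) :
    ∃ π : Equiv.Perm (Fin m), ∀ j : Fin m, p.getD j 0 = π j := by
  classical
  have hget : ∀ i : Fin m, p.getD i 0 = p[i.val]'(by rw [hlen]; exact i.isLt) := fun i =>
    List.getD_eq_getElem _ _ (by rw [hlen]; exact i.isLt)
  let f : Fin m → Fin m := fun i => ⟨p.getD i 0, hlt _ (by rw [hget i]; exact List.getElem_mem _)⟩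
  have hf : Function.Injective f := by
    intro i j h
    have h' : p.getD i 0 = p.getD j 0 := congrArg Fin.val h
    rw [hget i, hget j] at h'
    exact Fin.ext ((hnd.getElem_inj_iff).1 h')
  exact ⟨Equiv.ofBijective f hf.bijective_of_finite, fun j => rfl⟩

/-- **The list of images of a permutation.** [folklore] -/
theorem bavardGap_list_of_perm {m : ℕ} (π : Equiv.Perm (Fin m)) :
    (List.ofFn fun j : Fin m => ((π j : Fin m) : ℕ)).length = m ∧ (∀ a ∈ (List.ofFn fun j : Fin m => ((π j : Fin m) : ℕ)), a < m) ∧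
      (List.ofFn fun j : Fin m => ((π j : Fin m) : ℕ)).Nodup ∧ ∀ j : Fin m, (List.ofFn fun j : Fin m => ((π j : Fin m) : ℕ)).getD j 0 = π j := by
  refine ⟨List.length_ofFn, fun a ha => ?_, List.nodup_ofFn.2 (Fin.val_injective.comp π.injective), fun j => ?_⟩
  · rw [List.mem_ofFn] at ha
    obtain ⟨j, rfl⟩ := ha
    exact (π j).isLt
  · rw [List.getD_eq_getElem _ _ (by simp), List.getElem_ofFn]

/-- **The orbit-minimum count over `[0, m)` is the cycle count.** [folklore] -/
theorem bavardGap_filter_length_eq {m : ℕ} (π : Equiv.Perm (Fin m)) (p : List ℕ) (hp : ∀ j : Fin m, p.getD j 0 = π j) :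
    ((List.range m).filter fun i => decide (∀ k, k < m + 1 → i ≤ (fun c => p.getD ((c + 1) % m) 0)^[k] i)).length =
      Multiset.card (Equiv.Perm.cycleType ((finRotate m).trans π)) +
        (univ.filter fun c : Fin m => ((finRotate m).trans π) c = c).card := by
  classical
  rw [← bavardGap_card_orbitMin]
  have e : ((List.range m).filter fun i => decide (∀ k, k < m + 1 → i ≤ (fun c => p.getD ((c + 1) % m) 0)^[k] i)).length =
      ((Finset.range m).filter fun i => ∀ k, k < m + 1 → i ≤ (fun c => p.getD ((c + 1) % m) 0)^[k] i).card := by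
    rw [Finset.card_def, Finset.filter_val, Finset.range_val, Multiset.range, Multiset.filter_coe, Multiset.coe_card]
  rw [e]
  refine Finset.card_bij (fun i hi => ⟨i, Finset.mem_range.1 (Finset.mem_filter.1 hi).1⟩) (fun i hi => ?_) (fun i hi j hj h => ?_) (fun i hi => ?_)
  · rw [Finset.mem_filter] at hi ⊢
    refine ⟨Finset.mem_univ _, (bavardGap_orbitMin_iff_bounded _ _).2 fun k hk => ?_⟩
    rw [Fin.le_iff_val_le_val, bavardGap_val_pow_apply π p hp]
    exact hi.2 k (by omega)
  · exact Fin.mk.inj_iff.1 h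
  · refine ⟨i, ?_, rfl⟩
    rw [Finset.mem_filter] at hi ⊢
    refine ⟨Finset.mem_range.2 i.isLt, fun k _ => ?_⟩
    have h := hi.2 k
    rw [Fin.le_iff_val_le_val, bavardGap_val_pow_apply π p hp] at h
    exact h

/-- **The letter condition on values.** For `W = l.flatMap (fun a => [[a.1 = 1], a.2])` and `π` read off `p`: the pairing
matches letters with inverse letters iff the bit test of the verifier holds. [folklore] -/
theorem bavardGap_letters_iff (l : List (Fin 2 × Bool)) (π : Equiv.Perm (Fin l.length)) (p : List ℕ) (hp : ∀ j : Fin l.length, p.getD j 0 = π j) :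
    (∀ i, π i ≠ i) → ((∀ i, l.get (π i) = ((l.get i).1, !(l.get i).2)) ↔ ∀ i, i < l.length →
      (l.flatMap fun a => [decide (a.1 = 1), a.2]).getD (2 * p.getD i 0) false = (l.flatMap fun a => [decide (a.1 = 1), a.2]).getD (2 * i) false ∧
      (l.flatMap fun a => [decide (a.1 = 1), a.2]).getD (2 * p.getD i 0 + 1) false = !(l.flatMap fun a => [decide (a.1 = 1), a.2]).getD (2 * i + 1) false) := by
  intro _
  have key : ∀ i : Fin l.length, (l.get (π i) = ((l.get i).1, !(l.get i).2)) ↔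
      ((l.flatMap fun a => [decide (a.1 = 1), a.2]).getD (2 * p.getD i 0) false = (l.flatMap fun a => [decide (a.1 = 1), a.2]).getD (2 * i) false ∧
      (l.flatMap fun a => [decide (a.1 = 1), a.2]).getD (2 * p.getD i 0 + 1) false = !(l.flatMap fun a => [decide (a.1 = 1), a.2]).getD (2 * i + 1) false) := by
    intro i
    rw [hp i]
    obtain ⟨h1, h2⟩ := bavardGap_getD_flatMap l (π i) (π i).isLt
    obtain ⟨h3, h4⟩ := bavardGap_getD_flatMap l i i.isLt
    rw [h1, h2, h3, h4, Prod.ext_iff]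
    simp only [List.get_eq_getElem]
    refine and_congr ?_ Iff.rfl
    constructor
    · intro h; rw [h]
    · intro h
      have ha := Fin.is_lt (l[(π i : ℕ)]).1
      have hb := Fin.is_lt (l[(i : ℕ)]).1
      rw [Bool.eq_iff_iff, decide_eq_true_iff, decide_eq_true_iff, Fin.ext_iff, Fin.ext_iff] at h
      apply Fin.ext
      simp only [Fin.val_one] at h
      omega
  constructor
  · intro h i hi; exact (key ⟨i, hi⟩).1 (h ⟨i, hi⟩)
  · intro h i; exact (key i).2 (h i i.isLt)

end Summit.PneNP.PneNP.Theorems
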